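import Summits.AtomisticToContinuum.HydrodynamicLimit.Theses.JParityClosure
import Literature.Analysis.FluidPDE.HardSphereCollisionRecord
import Literature.Analysis.FluidPDE.HardSphereFreeStretch

/-!
# Sketch — crux-ideate stmt-AtomisticToContinuum-13080 (`JParityClosure.RateFloor`), round 1, ideator 3

First lemmas of the three idea cards (statements must elaborate; proofs are not required at this
stage — the purely combinatorial core of card 1 is nevertheless PROVED below, sorry-free).

* Card `preemption-minmax-transfer`: `preempt_card_le` (proved), `PerParticleFreeStretch`,
  `WouldBeRealised`, `wouldBeCount`.
* Card `regeneration-spreading-uniformity`: `GainSpreading`.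
* Card `sonic-dichotomy-static-residue`: `CollisionEquipartition`.
-/

noncomputable section

open MeasureTheory Set
open scoped InnerProductSpace RealInnerProductSpace BigOperators
open Literature.MathematicalPhysics.KineticTheory Literature.Analysis.FluidPDE

namespace Summit.AtomisticToContinuum.HydrodynamicLimit.Cruxes.RateFloor.IdeatorThree

/-! ## Card 1 — the pre-emption counting inequality (kinematic transfer) -/

section Counting

variable {ι : Type*} [Fintype ι] [DecidableEq ι]

/-- Particles touched by a finite set of ordered pairs (the DEFLECTED set of a window: every
particle that takes part in at least one actual collision of the window). [folklore] -/
def touched (A : Finset (ι × ι)) : Finset ι := A.image Prod.fst ∪ A.image Prod.snd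

/-- The `W`-star of a particle: would-be pairs having `i` as an endpoint. [folklore] -/
def star (W : Finset (ι × ι)) (i : ι) : Finset (ι × ι) := W.filter fun p => p.1 = i ∨ p.2 = i

/-- The clustering correction `C₂(W)`: total `W`-degree carried by particles of `W`-degree ≥ 2
(for a dilute configuration and a window of `A` mean free times this is `O(A²)·N`). [folklore] -/
def clusterExcess (W : Finset (ι × ι)) : ℕ :=
  ∑ i ∈ Finset.univ.filter (fun i => 2 ≤ (star W i).card), (star W i).card

omit [Fintype ι] in
/-- At most two particles per actual collision. [folklore] -/
theorem card_touched_le (A : Finset (ι × ι)) : (touched A).card ≤ 2 * A.card := by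
  unfold touched
  calc (A.image Prod.fst ∪ A.image Prod.snd).card
      ≤ (A.image Prod.fst).card + (A.image Prod.snd).card := Finset.card_union_le _ _
    _ ≤ A.card + A.card := Nat.add_le_add Finset.card_image_le Finset.card_image_le
    _ = 2 * A.card := by ring

/-- **Pre-emption counting inequality (card 1, combinatorial core; PROVED).**  If every would-be
pair of the window touches the deflected set of the actual collisions `A` of the window (a
would-be pair is either realised — then it is in `A` — or pre-empted, i.e. one of its members
collided with a third particle first), then `#W ≤ 2·#A + C₂(W)`: the actual collisions of the
window number at least `(#W − C₂(W))/2`, with NO assumption on which particles get deflected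
(worst case over conspiracies).  [folklore] -/
theorem preempt_card_le (W A : Finset (ι × ι))
    (hW : ∀ p ∈ W, p.1 ∈ touched A ∨ p.2 ∈ touched A) :
    W.card ≤ 2 * A.card + clusterExcess W := by
  classical
  -- every would-be pair lies in the star of a deflected particle
  have hcover : W ⊆ (touched A).biUnion (star W) := by
    intro p hp
    rcases hW p hp with h | h
    · exact Finset.mem_biUnion.2 ⟨p.1, h, Finset.mem_filter.2 ⟨hp, Or.inl rfl⟩⟩
    · exact Finset.mem_biUnion.2 ⟨p.2, h, Finset.mem_filter.2 ⟨hp, Or.inr rfl⟩⟩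
  have h1 : W.card ≤ ∑ i ∈ touched A, (star W i).card :=
    (Finset.card_le_card hcover).trans Finset.card_biUnion_le
  -- split the deflected particles by `W`-degree ≤ 1 / ≥ 2
  have h2 : ∑ i ∈ touched A, (star W i).card
      ≤ ∑ i ∈ (touched A).filter (fun i => (star W i).card ≤ 1), (star W i).card
        + ∑ i ∈ (touched A).filter (fun i => ¬ (star W i).card ≤ 1), (star W i).card := by
    rw [Finset.sum_filter_add_sum_filter_not]
  have h3 : ∑ i ∈ (touched A).filter (fun i => (star W i).card ≤ 1), (star W i).card
      ≤ (touched A).card := by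
    calc ∑ i ∈ (touched A).filter (fun i => (star W i).card ≤ 1), (star W i).card
        ≤ ∑ i ∈ (touched A).filter (fun i => (star W i).card ≤ 1), 1 :=
          Finset.sum_le_sum fun i hi => (Finset.mem_filter.1 hi).2
      _ = ((touched A).filter (fun i => (star W i).card ≤ 1)).card := by simp
      _ ≤ (touched A).card := Finset.card_filter_le _ _
  have h4 : ∑ i ∈ (touched A).filter (fun i => ¬ (star W i).card ≤ 1), (star W i).card
      ≤ clusterExcess W := by
    unfold clusterExcess
    apply Finset.sum_le_sum_of_subset_of_nonneg
    · intro i hi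
      rw [Finset.mem_filter] at hi ⊢
      exact ⟨Finset.mem_univ i, by omega⟩
    · intro i _ _
      exact Nat.zero_le _
  have h5 := card_touched_le A
  omega

end Counting

/-! ### Card 1 — kinematic realisation (statements; the tree has the whole-configuration
versions `IsHardSphereTrajectory.apply_fst_eq_freeFlight_of_Ioo_free` /
`not_mem_collisionTimes_of_freeFlight_ne`; the per-particle forms below are the first lemmas) -/

/-- **Per-particle free stretch.** A particle that takes part in no collision during `(s, t]`
moves freely on `[s, t]`, whatever the other particles do (field `free` between consecutive
collision times + `collidePair_apply_of_ne` at collisions of other pairs; finitely many by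
`locFinite`).  [folklore] -/
def PerParticleFreeStretch : Prop :=
  ∀ (N : ℕ) (ε : ℝ) (γ : ℝ → Config N (Fin 3) T3),
    IsHardSphereTrajectory (Torus.geometry (Fin 3)) ε N γ →
    ∀ (s t : ℝ) (k : Fin N), s ≤ t →
      (∀ u ∈ Set.Ioc s t, u ∉ collisionTimesOf (Torus.geometry (Fin 3)) ε γ k) →
      γ t k = freeFlight (Torus.geometry (Fin 3)) (t - s) (γ s) k

/-- **Would-be pairs are realised unless pre-empted.** If the free flights of particles `i ≠ j`
issued from `γ s` are at distance `ε` at time `t > s`, and neither `i` nor `j` takes part in any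
collision during `(s, t)`, then `i` and `j` collide at time `t` (positions are continuous and
equal to the free-flight positions on `[s, t]` by `PerParticleFreeStretch`; contact inside the
hard-sphere domain is `Collide`).  Together with `preempt_card_le` this turns a lower bound on
actual collisions in a window into a count of FREE-FLIGHT would-be pairs of the configuration at
the start of the window — a single-time, static functional.  [folklore] -/
def WouldBeRealised : Prop :=
  ∀ (N : ℕ) (ε : ℝ) (γ : ℝ → Config N (Fin 3) T3),
    IsHardSphereTrajectory (Torus.geometry (Fin 3)) ε N γ →
    ∀ (s t : ℝ) (i j : Fin N), s < t → i ≠ j →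
      (∀ u ∈ Set.Ioo s t, u ∉ collisionTimesOf (Torus.geometry (Fin 3)) ε γ i) →
      (∀ u ∈ Set.Ioo s t, u ∉ collisionTimesOf (Torus.geometry (Fin 3)) ε γ j) →
      ‖(Torus.geometry (Fin 3)).sepVec (freeFlight (Torus.geometry (Fin 3)) (t - s) (γ s) i).1
          (freeFlight (Torus.geometry (Fin 3)) (t - s) (γ s) j).1‖ = ε →
      Collide (Torus.geometry (Fin 3)) ε (γ t) i j

open scoped Classical in
/-- The static WOULD-BE functional of card 1: ordered pairs of distinct particles whose free
flights come within `ε` of each other during `(0, Δ]` (Boltzmann's collision cylinders read on the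
ACTUAL configuration `z`; for `Δ = A·t_mfp` with `A ≪ 1` and reduced density `φ ≪ A` these pairs
sit at separations `≍ A·mfp ≫ ε`, out of reach of contact-scale shadowing).  [folklore] -/
def wouldBeCount {N : ℕ} (ε Δ : ℝ) (z : Config N (Fin 3) T3) : ℕ :=
  (Finset.univ.filter fun p : Fin N × Fin N => p.1 ≠ p.2 ∧
    ∃ t ∈ Set.Ioc 0 Δ, ‖(Torus.geometry (Fin 3)).sepVec
      (freeFlight (Torus.geometry (Fin 3)) t z p.1).1
      (freeFlight (Torus.geometry (Fin 3)) t z p.2).1‖ ≤ ε).card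

/-! ## Card 2 — gain-term spreading (Carleman / Pulvirenti–Wennberg transplanted to `reflectVel`) -/

/-- **Spreading floor for the hard-sphere gain push-forward.** The image of
`1_{B_R}(v) 1_{B_R}(w) ((w−v)·ω)₊ dω dv dw` under the out-velocity map `(v, w, ω) ↦ v'` dominates a
multiple of Lebesgue measure on `B_R`: one collision with thermal-bulk partners re-populates EVERY
out-velocity cell at a rate bounded below (isotropy of hard-sphere scattering in the centre-of-mass
frame; PW97 Lemma 3.1-type).  [folklore] -/
def GainSpreading : Prop :=
  ∀ R : ℝ, 0 < R → ∃ c : ℝ, 0 < c ∧ ∀ S : Set V3, MeasurableSet S → S ⊆ Metric.ball (0 : V3) R →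
    c * (volume S).toReal ≤
      ∫ v in Metric.ball (0 : V3) R, ∫ w in Metric.ball (0 : V3) R,
        ∫ ω : Metric.sphere (0 : V3) 1,
          S.indicator (fun _ => (1 : ℝ)) (reflectVel (ω : V3) (v, w)).1 *
            hardSphereKernel (w, v) ω ∂sphereMeasure

/-! ## Card 3 — the collision equipartition identity (engine of "interpenetrating streams thermalise
at the collision rate") -/

/-- **Hard-sphere equipartition per collision.** Averaged over the impact geometry with the
hard-sphere rate `((w−v)·ω)₊ dω` (total mass `π‖w−v‖`), a collision hands particle 1 exactly HALF the
kinetic-energy gap: `∫ (‖v'‖² − ‖v‖²)((w−v)·ω)₊ dω = (π/2)‖w−v‖(‖w‖² − ‖v‖²)`, in every inertial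
frame (pointwise `‖v'‖² − ‖v‖² = ((w−v)·ω)((v+w)·ω)`, then `∫_{e·ω>0}(e·ω)³dω = π/2`).  Energy flows
from the faster to the slower particle ON AVERAGE OVER THE IMPACT DISC, deterministically in
`(v, w)` — the only "second law" card 3 uses.  [folklore] -/
def CollisionEquipartition : Prop :=
  ∀ v w : V3,
    ∫ ω : Metric.sphere (0 : V3) 1,
        (‖(reflectVel (ω : V3) (v, w)).1‖ ^ 2 - ‖v‖ ^ 2) * hardSphereKernel (w, v) ω ∂sphereMeasure
      = Real.pi / 2 * ‖w - v‖ * (‖w‖ ^ 2 - ‖v‖ ^ 2)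

/-- Pointwise form of the equipartition identity (the integrand before averaging). [folklore] -/
theorem norm_sq_reflectVel_fst_sub (ω : Metric.sphere (0 : V3) 1) (v w : V3) :
    ‖(reflectVel (ω : V3) (v, w)).1‖ ^ 2 - ‖v‖ ^ 2 = ⟪w - v, (ω : V3)⟫_ℝ * ⟪v + w, (ω : V3)⟫_ℝ := by
  have hω : ‖(ω : V3)‖ = 1 := norm_eq_of_mem_sphere ω
  have key : (reflectVel (ω : V3) (v, w)).1 = v - ⟪v - w, (ω : V3)⟫_ℝ • (ω : V3) := by
    simp only [reflectVel, hω, one_pow, div_one]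
  rw [key, @norm_sub_sq_real, norm_smul, Real.norm_eq_abs, hω, mul_one, sq_abs, inner_smul_right,
    inner_sub_left, inner_sub_left, inner_add_left]
  ring

/-- The crux, for reference (the cards never restate it). -/
example : Prop := Summit.AtomisticToContinuum.HydrodynamicLimit.Theses.JParityClosure.RateFloor

end Summit.AtomisticToContinuum.HydrodynamicLimit.Cruxes.RateFloor.IdeatorThree
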